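import Mathlib
import HarnessLib
import Summits.HubbardSuperconductivity.HubbardSuperconductivity.Theorems.KLProgrammeKLRegimeSplitGlueP4
import Summits.HubbardSuperconductivity.HubbardSuperconductivity.Theorems.KLProgrammeKLRegimeVolumeLimitExDefs
import Summits.HubbardSuperconductivity.HubbardSuperconductivity.Theorems.KLProgrammeKLRegimeSplitBundleV16
import Summits.HubbardSuperconductivity.HubbardSuperconductivity.Theorems.KLProgrammeKLRegimeSplitGlueV15P4Ex

/-!
# Route `KLProgramme` — the K3-NAMED glue of the five gen-6 children at `klPredsV16` with the ∃-threshold volume-limit slot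
# `FinalTwoLegVolLimitEx` (stmt-HubbardSuperconductivity-19937; DOWNSTREAM of the route file; seat p2 g9, plan g14 (R18) assignment (1))

`KLRegimeInductionV16P4Ex := KLRegimeInductionP4 klPredsV16 FinalTwoLegVolLimitEx` (the generic induction `KLRegimeInductionP4` is universal in the
bundle `Pr` and the volume-limit slot).  Nothing else is asserted; nothing asserts superconductivity.
-/

noncomputable section

namespace Summit.HubbardSuperconductivity.HubbardSuperconductivity.Theorems.KLRegimeSplit

set_option linter.dupNamespace false -- summit = problem name (single-conjunct summit), D-0017

/-- **The K3-named glue at `klPredsV16` with the ∃-slot**: `EngineP4 klPredsV16 klWindowC`, `BetaSplitP klPredsV16 klWindowC`,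
`CountertermP2 klPredsV16 klWindowC`, `VolumeLimitP2 klPredsV16 FinalTwoLegVolLimitEx klWindowC`, `TwoPointAssemblyP3 klPredsV16 FinalTwoLegVolLimitEx klWindowC`
imply crux K3 `KLRegimeTwoPointLimit` BY NAME. -/
theorem KLRegimeInductionV16P4Ex :
    EngineP4 klPredsV16 klWindowC → BetaSplitP klPredsV16 klWindowC → CountertermP2 klPredsV16 klWindowC →
      VolumeLimitP2 klPredsV16 FinalTwoLegVolLimitEx klWindowC → TwoPointAssemblyP3 klPredsV16 FinalTwoLegVolLimitEx klWindowC →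
        Summit.HubbardSuperconductivity.HubbardSuperconductivity.Theses.KLProgramme.KLRegimeTwoPointLimit :=
  KLRegimeInductionP4 klPredsV16 FinalTwoLegVolLimitEx

/-- **(R6-3) at V16**: the bare frame is in `klPredsV16.frameOK` (= `FrameOKDeg`) on the covariance window (`frameOKDeg_zeroC`, `…SplitGlueV15P4Ex`). -/
theorem klPredsV16_frameOK_zeroC {R : RenConsts} (hR : R.WF) (U : ℝ) (N : ℕ) {μ : ℝ} (hμ : μ ∈ klWindowC) : klPredsV16.frameOK R U N μ 0 :=
  frameOKDeg_zeroC hR U N hμ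

end Summit.HubbardSuperconductivity.HubbardSuperconductivity.Theorems.KLRegimeSplit

end
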